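import Summits.CriticalPhenomena.PercolationContinuityZ3.Theorems.PercNearOneGluingNoHeavyLowerTailSahiCTCRtForm
import Summits.CriticalPhenomena.PercolationContinuityZ3.Theorems.PercNearOneGluingNoHeavyLowerTailSahiCTCDownLYM
import Summits.CriticalPhenomena.PercolationContinuityZ3.Theorems.PercNearOneGluingNoHeavyLowerTailSahiCTCEdgeHarris
import HarnessLib

/-!
# `NoHeavyLowerTail` (crux stmt-CriticalPhenomena-4575), P3 lane: `R_t ∈ ℕ[s]` FOR EVERY `t` WHENEVER THE LARGE MEMBERS OF ONE UP-SET
# LIE IN THE OTHER ("big-nested" pairs) — and the top-heavy LYM bracket `Π·X_{≥t} − X·Θ_{≥t} ∈ ℕ[s]`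

Support file (seat `prim-l12-p3`, gen 33; `--supports stmt-CriticalPhenomena-4575`).  Memo `run/shared/lean/prim/prim-l12/FROM-prim-l12-p3-g33-
DOMINANCE-MATCHING.md` §4.6.  Setting of `…SahiCTCRtForm`: for up-sets `𝒳, 𝒵 ⊆ 2^α` and a threshold `t`, `X = GF(𝒳)`, `X_{≥t} = GF(atLeast t 𝒳)`,
`X_{<t} = GF(below t 𝒳)`, `Θ_{<t}`, `Θ_{≥t}` the generating functions of all sets of size `< t` / `≥ t`, `Π = Θ_{<t} + Θ_{≥t}`, and
    `R_t(𝒳,𝒵) = Θ_{<t}·(Π·Y_{≥t} − X·Z) + Π·X_{<t}·Z_{<t}`     (`Rt t 𝒳 𝒵`),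
the R-half of the level-`t` master form (`Mop_eq_ladderT_add_Rt`); `R_t ∈ ℕ[s]` for all pairs and all `t` is the coefficientwise transfer
principle of the lane (value level ⇔ `Cov_μ(𝒳,𝒵) ≥ P(N<t)·Cov(𝒳,𝒵 | N<t)`).  Known in the tree: `t = 2` (`coeff_Rt_two_nonneg`), no common members
of size `< t` (`coeff_Rt_nonneg_of_below_inter_eq_empty`), nested / one-sided complexes (`…NcSplitNestedR`, `…NcSplitOneSided`).
THREE-SET NORMAL FORM (memo §4.6): `[s^m]R_t = N₁ + N₂ − N₃ − N₄` with, over triples `(x,y,z)`, `x+y+z = m`, `|x| ≥ t > |z|`: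
`N₁ = #{x ∈ 𝒳∩𝒵, y ∉ 𝒳, z ∉ 𝒵}`, `N₂ = #{x ∉ 𝒳∪𝒵, y ∈ 𝒳, z ∈ 𝒵}`, `N₃ = #{x ∈ 𝒳∖𝒵, y ∉ 𝒳, z ∈ 𝒵}`, `N₄ = #{x ∈ 𝒵∖𝒳, y ∈ 𝒳, z ∉ 𝒵}`,
and `N₁ ≥ N₃`, `N₁ ≥ N₄` by the top-heavy Kleitman lemma; so `R_t ∈ ℕ[s]` as soon as `N₃ = 0`, e.g. when every member of `𝒳` of size
`≥ t` belongs to `𝒵`.  THIS FILE proves that case in generating-function language: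
* `coeff_PiP_mul_atLeast_sub_nonneg` : **top-heavy LYM**, `Π·X_{≥t} − X·Θ_{≥t} ∈ ℕ[s]` for every up-set `𝒳` and every `t`
  (`= Σ_{c<t≤j} (e_c·GF(𝒳_j) − e_j·GF(𝒳_c))`, each bracket `≥ 0` by `coeff_weightedLYM`);
* `Rt_eq_of_atLeast_subset` : for `atLeast t 𝒳 ⊆ 𝒵` the STRUCTURE IDENTITY
    `R_t = GF(Θ_{<t} ∖ 𝒵_{<t})·(Π·X_{≥t} − X·Z_{≥t}) + GF(Θ_{≥t} ∖ 𝒵_{≥t})·X·Z_{<t}`;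
* **`coeff_Rt_nonneg_of_atLeast_subset`** : `R_t(𝒳,𝒵) ∈ ℕ[s]` for all up-sets with `atLeast t 𝒳 ⊆ 𝒵` (every `t`, every finite type), and
  `coeff_Rt_nonneg_of_atLeast_subset'` (the mirror case `atLeast t 𝒵 ⊆ 𝒳`, via `Rt_comm`); `coeff_Rt_nonneg_of_subset` : nested pairs `𝒳 ⊆ 𝒵`.
Nothing is asserted about the crux.
-/

noncomputable section

open scoped Classical

namespace Summit.CriticalPhenomena.PercolationContinuityZ3.Theorems

namespace SahiCTCForms

open Finset MvPolynomial SahiCTCGenFun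

variable {α : Type*} [DecidableEq α] [Fintype α]

/-! ### Top-heavy LYM: `Π·X_{≥t} − X·Θ_{≥t} ∈ ℕ[s]` -/

/-- `GF{S ∈ F : q #S}` graded by size over `range (card α + 1)`. [this work] -/
private theorem gf_filter_card_eq_sum_univ (F : Finset (Finset α)) (q : ℕ → Prop) [DecidablePred q] :
    gf (F.filter fun S => q #S) = ∑ k ∈ (range (Fintype.card α + 1)).filter q, gf (F.filter fun S => #S = k) := by
  have hF : ∀ S ∈ F, S ⊆ (univ : Finset α) := fun S _ => subset_univ S
  rw [gf_filter_card_eq_sum hF q, card_univ]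

/-- **Top-heavy LYM (polynomial form)**: for an up-set `𝒳` and every threshold `t`, `Π·GF(𝒳_{≥t}) − GF(𝒳)·Θ_{≥t}` has nonnegative
coefficients — after cancelling the antisymmetric block `c, j ≥ t` it is `Σ_{c<t≤j} (e_c·GF(𝒳_j) − e_j·GF(𝒳_c))`, each bracket `≥ 0` by weighted LYM
(`coeff_weightedLYM`).  Combinatorially: at every profile, the members of the trace of `𝒳` in the top levels outnumber those in the mirror
bottom levels. [this work] -/
theorem coeff_PiP_mul_atLeast_sub_nonneg {F : Finset (Finset α)} (hF : IsUpperSet (F : Set (Finset α))) (t : ℕ) (n : α →₀ ℕ) :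
    0 ≤ (PiP * gf (atLeast t F) - gf F * gf (bySize (t ≤ ·))).coeff n := by
  set R := range (Fintype.card α + 1) with hR
  set Rlt := R.filter (fun k => ¬ t ≤ k) with hRlt
  set Rge := R.filter (fun k => t ≤ k) with hRge
  -- graded decompositions
  -- level pieces: `E k = e_k` (all `k`-sets), `Fk k = GF(𝒳_k)`
  set E : ℕ → MvPolynomial α ℤ := fun k => gf ((univ : Finset α).powerset.filter fun P => #P = k) with hE
  set Fk : ℕ → MvPolynomial α ℤ := fun k => gf (F.filter fun S => #S = k) with hFk
  have hPi : (PiP : MvPolynomial α ℤ) = ∑ k ∈ Rge, E k + ∑ k ∈ Rlt, E k := by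
    unfold PiP; rw [gf_eq_sum_levels, ← sum_filter_add_sum_filter_not R (fun k => t ≤ k)]
  have hX : gf F = ∑ k ∈ Rge, Fk k + ∑ k ∈ Rlt, Fk k := by
    rw [gf_eq_sum_levels F, ← sum_filter_add_sum_filter_not R (fun k => t ≤ k)]
  have hXU : gf (atLeast t F) = ∑ k ∈ Rge, Fk k := by
    unfold atLeast; rw [gf_filter_card_eq_sum_univ]
  have hTU : gf (bySize (t ≤ ·) : Finset (Finset α)) = ∑ k ∈ Rge, E k := by
    unfold bySize
    have h := gf_filter_card_eq_sum_univ ((univ : Finset α).powerset) (fun k => t ≤ k)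
    rw [h]
  -- the bracket as a double sum over `c < t ≤ j`
  have key : PiP * gf (atLeast t F) - gf F * gf (bySize (t ≤ ·)) =
      ∑ c ∈ Rlt, ∑ j ∈ Rge, (E c * Fk j - E j * Fk c) := by
    rw [hPi, hX, hXU, hTU]
    have e1 : (∑ k ∈ Rge, E k + ∑ k ∈ Rlt, E k) * ∑ k ∈ Rge, Fk k -
        (∑ k ∈ Rge, Fk k + ∑ k ∈ Rlt, Fk k) * ∑ k ∈ Rge, E k =
        (∑ k ∈ Rlt, E k) * (∑ k ∈ Rge, Fk k) - (∑ k ∈ Rlt, Fk k) * (∑ k ∈ Rge, E k) := by ring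
    rw [e1, sum_mul_sum, sum_mul_sum, ← sum_sub_distrib]
    refine sum_congr rfl fun c _ => ?_
    rw [← sum_sub_distrib]
    refine sum_congr rfl fun j _ => ?_
    ring
  rw [key, coeff_sum]
  refine sum_nonneg fun c hc => ?_
  rw [coeff_sum]
  refine sum_nonneg fun j hj => ?_
  have hct : ¬ t ≤ c := (mem_filter.1 hc).2
  have hjt : t ≤ j := (mem_filter.1 hj).2
  have hcj : c ≤ j := by omega
  rw [coeff_sub, sub_nonneg]
  exact coeff_weightedLYM hF hcj n

/-! ### The structure identity and `R_t ∈ ℕ[s]` for big-nested pairs -/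

/-- `R_t` is symmetric in the two families. [this work] -/
theorem Rt_comm (t : ℕ) (F G : Finset (Finset α)) : Rt t F G = Rt t G F := by
  unfold Rt; rw [inter_comm]; ring

omit [Fintype α] in
/-- If every member of `𝒳` of size `≥ t` belongs to `𝒵`, the large common members are the large members of `𝒳`. [this work] -/
theorem atLeast_inter_eq_of_atLeast_subset {t : ℕ} {F G : Finset (Finset α)} (h : atLeast t F ⊆ G) :
    atLeast t (F ∩ G) = atLeast t F := by
  ext S
  unfold atLeast at h ⊢
  simp only [mem_filter, mem_inter]
  constructor
  · rintro ⟨⟨hSF, _⟩, hS⟩; exact ⟨hSF, hS⟩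
  · rintro ⟨hSF, hS⟩; exact ⟨⟨hSF, h (mem_filter.2 ⟨hSF, hS⟩)⟩, hS⟩

omit [DecidableEq α] in
/-- Small members of `𝒵` are small sets. [this work] -/
theorem below_subset_bySize (t : ℕ) (G : Finset (Finset α)) : below t G ⊆ (bySize (· < t) : Finset (Finset α)) := by
  intro S hS
  unfold below at hS; unfold bySize
  exact mem_filter.2 ⟨mem_powerset.2 (subset_univ S), (mem_filter.1 hS).2⟩

omit [DecidableEq α] in
/-- Large members of `𝒵` are large sets. [this work] -/
theorem atLeast_subset_bySize (t : ℕ) (G : Finset (Finset α)) : atLeast t G ⊆ (bySize (t ≤ ·) : Finset (Finset α)) := by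
  intro S hS
  unfold atLeast at hS; unfold bySize
  exact mem_filter.2 ⟨mem_powerset.2 (subset_univ S), (mem_filter.1 hS).2⟩

/-- **Structure identity for big-nested pairs**: if `atLeast t 𝒳 ⊆ 𝒵` then
`R_t = GF(Θ_{<t} ∖ 𝒵_{<t})·(Π·X_{≥t} − X·Z_{≥t}) + GF(Θ_{≥t} ∖ 𝒵_{≥t})·X·Z_{<t}` — a sum of two products of series with nonnegative coefficients
(the bracket by top-heavy LYM).  Counting triples `(x,y,z)` with `|x| ≥ t > |z|`: the first product is `N₁ − N₄`, the second `N₂` of the three-set form. [this work] -/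
theorem Rt_eq_of_atLeast_subset {t : ℕ} {F G : Finset (Finset α)} (h : atLeast t F ⊆ G) :
    Rt t F G = gf ((bySize (· < t) : Finset (Finset α)) \ below t G) * (PiP * gf (atLeast t F) - gf F * gf (atLeast t G)) +
      gf ((bySize (t ≤ ·) : Finset (Finset α)) \ atLeast t G) * gf F * gf (below t G) := by
  have e1 : atLeast t (F ∩ G) = atLeast t F := atLeast_inter_eq_of_atLeast_subset h
  have e2 : gf G = gf (atLeast t G) + gf (below t G) := gf_eq_atLeast_add_below t G
  have e2' : gf F = gf (atLeast t F) + gf (below t F) := gf_eq_atLeast_add_below t F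
  have e3 : (PiP : MvPolynomial α ℤ) = gf (bySize (· < t)) + gf (bySize (t ≤ ·)) := PiP_eq_bySize_lt_add_ge t
  have e4 : gf ((bySize (· < t) : Finset (Finset α)) \ below t G) = gf (bySize (· < t)) - gf (below t G) :=
    gf_sdiff_eq (below_subset_bySize t G)
  have e5 : gf ((bySize (t ≤ ·) : Finset (Finset α)) \ atLeast t G) = gf (bySize (t ≤ ·)) - gf (atLeast t G) :=
    gf_sdiff_eq (atLeast_subset_bySize t G)
  rw [e4, e5]
  unfold Rt
  rw [e1, e2, e2']
  -- abstract the atoms and finish by commutative-ring normalisation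
  set TD : MvPolynomial α ℤ := gf (bySize (· < t))
  set TU : MvPolynomial α ℤ := gf (bySize (t ≤ ·))
  set XU := gf (atLeast t F)
  set ZU := gf (atLeast t G)
  set ZD := gf (below t G)
  set XD := gf (below t F)
  rw [e3]
  ring

/-- **`R_t ∈ ℕ[s]` for every `t` and every pair of up-sets `𝒳, 𝒵` with `atLeast t 𝒳 ⊆ 𝒵`** (every member of `𝒳` of size `≥ t` lies in `𝒵`;
contains the nested case `𝒳 ⊆ 𝒵` and the regime "`𝒵` has no member of size `< t`" is the mirror statement). [this work] -/
theorem coeff_Rt_nonneg_of_atLeast_subset {t : ℕ} {F G : Finset (Finset α)} (hF : IsUpperSet (F : Set (Finset α)))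
    (h : atLeast t F ⊆ G) (n : α →₀ ℕ) : 0 ≤ (Rt t F G).coeff n := by
  rw [Rt_eq_of_atLeast_subset h, coeff_add]
  have hbr : ∀ m, 0 ≤ (PiP * gf (atLeast t F) - gf F * gf (atLeast t G)).coeff m := by
    intro m
    have e : PiP * gf (atLeast t F) - gf F * gf (atLeast t G) =
        (PiP * gf (atLeast t F) - gf F * gf (bySize (t ≤ ·))) + gf F * gf ((bySize (t ≤ ·) : Finset (Finset α)) \ atLeast t G) := by
      rw [gf_sdiff_eq (atLeast_subset_bySize t G)]; ring
    rw [e, coeff_add]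
    exact add_nonneg (coeff_PiP_mul_atLeast_sub_nonneg hF t m) (coeff_mul_nonneg (coeff_gf_nonneg _) (coeff_gf_nonneg _) m)
  refine add_nonneg (coeff_mul_nonneg (coeff_gf_nonneg _) hbr n) ?_
  exact coeff_mul_nonneg (coeff_mul_nonneg (coeff_gf_nonneg _) (coeff_gf_nonneg _)) (coeff_gf_nonneg _) n

/-- Mirror case: `R_t(𝒳,𝒵) ∈ ℕ[s]` whenever `atLeast t 𝒵 ⊆ 𝒳`. [this work] -/
theorem coeff_Rt_nonneg_of_atLeast_subset' {t : ℕ} {F G : Finset (Finset α)} (hG : IsUpperSet (G : Set (Finset α)))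
    (h : atLeast t G ⊆ F) (n : α →₀ ℕ) : 0 ≤ (Rt t F G).coeff n := by
  rw [Rt_comm]; exact coeff_Rt_nonneg_of_atLeast_subset hG h n

/-- **Nested pairs**: `R_t(𝒳,𝒵) ∈ ℕ[s]` for every `t` whenever `𝒳 ⊆ 𝒵` (up-set `𝒳`). [this work] -/
theorem coeff_Rt_nonneg_of_subset {t : ℕ} {F G : Finset (Finset α)} (hF : IsUpperSet (F : Set (Finset α))) (h : F ⊆ G)
    (n : α →₀ ℕ) : 0 ≤ (Rt t F G).coeff n :=
  coeff_Rt_nonneg_of_atLeast_subset hF (fun S hS => h (by unfold atLeast at hS; exact (mem_filter.1 hS).1)) n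

end SahiCTCForms

end Summit.CriticalPhenomena.PercolationContinuityZ3.Theorems
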